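import Summits.CriticalPhenomena.PercolationContinuityZ3.Theorems.Transplant.ObliqueFilmsResidue
import Summits.CriticalPhenomena.PercolationContinuityZ3.Theorems.Transplant.HexShadowInjective
import HarnessLib

/-!
# THE `(111)`-ROW COMPLETE WITHOUT p205010 (every thickness `k ≥ 1`), and TARGET 2x REDUCED TO THE DIAMOND FILMS OF THICKNESS `≥ 3`

builds on p205010 (kernel theorem, internal audit signed; external expert review pending) — NOT used: p205010's declarations are absent from the DECLARATION-LEVEL cones
of the theorems below (the import graph of the lane is not separated; by name the whole target is closed through p205010 in «DiamondFilmOwnCriticalContinuityHolds»).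
Lane `prim-bschramm`, seat `prim-bschramm-p2` (gen 40; class C1b = films / other 3D lattices at their own critical point, METHOD = input substitution;
memo `HOME/bschramm/P2-LATTICES.md` §141); helper file (`--supports stmt-CriticalPhenomena-4575 --as helper`).

With the dice lattice `F_2` closed by the vacuous routing node («HexShadowInjective».`slab111OwnCriticalContinuity_k2`), the `(111)`-films
`F_k = {x ∈ ℤ³ : 0 ≤ x₀+x₁+x₂ ≤ k}` die at their own critical point for EVERY `k ≥ 1` by p205010-free proof objects: `k = 1` honeycomb (Wierman, «Slab111Honeycomb»),
`k = 2` dice (DST with injective shadow), `k = 3` (radius-4 certificates, «Slab111K3Continuity»), `4 ≤ k ≤ 9` (radius-3 bitboard certificates, «Slab111SKFinalK4…K9»),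
`k ≥ 10` (zone-free hub dispatcher, «Slab111HubXFinal») — the row `∀ k ≥ 1, Slab111OwnCriticalContinuity k` has the p205010-free proof term
`fun k hk => if h : k = 2 then h ▸ slab111OwnCriticalContinuity_k2 else slab111OwnCriticalContinuity_ne_two hk h` (not re-landed as a theorem: its STATEMENT coincides with the by-name
row `slab111OwnCriticalContinuity_of_one_le`, dedup).  Consequently TARGET 2x («StatementObliqueFilms».`ObliqueFilmOwnCriticalContinuity`) is EQUIVALENT, without p205010, to
its last residue: the diamond `(001)`-films of thickness `k ≥ 3` — **`obliqueFilmOwnCriticalContinuity_iff_diamond`** (square shadow symmetry; the diamond film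
`k = 2` is the subdivided square lattice, «DiamondFilmTwoSubdiv»).
[cite: BenjaminiSchramm1996, Conj. 4 / Question 3] [cite: DuminilCopinSidoraviciusTassion2016, Thm. 1 + p. 3 "Two generalizations"]
-/

noncomputable section

namespace Summit.CriticalPhenomena.PercolationContinuityZ3.Theorems.Transplant

open Literature.Probability.Percolation Literature.Probability.LatticeModels SimpleGraph

/-- **TARGET 2x WITHOUT p205010 IS EQUIVALENT TO ITS LAST RESIDUE: the diamond `(001)`-films of thickness `k ≥ 3`** (the `(111)`-row is complete; the diamond
film `k = 2` is the subdivided square lattice). [cite: BenjaminiSchramm1996, Conj. 4 / Question 3] [cite: DuminilCopinSidoraviciusTassion2016, Thm. 1] -/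
theorem obliqueFilmOwnCriticalContinuity_iff_diamond :
    ObliqueFilmOwnCriticalContinuity ↔ ∀ k : ℕ, 3 ≤ k → DiamondFilmOwnCriticalContinuity k := by
  rw [obliqueFilmOwnCriticalContinuity_iff_residue]
  exact ⟨fun h => h.2, fun h => ⟨slab111OwnCriticalContinuity_k2, h⟩⟩

/-- **TARGET 2x FROM THE DIAMOND FILMS ALONE**: `(∀ k ≥ 3, DiamondFilmOwnCriticalContinuity k) → ObliqueFilmOwnCriticalContinuity`, without p205010.
[cite: BenjaminiSchramm1996, Conj. 4 / Question 3] -/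
theorem obliqueFilmOwnCriticalContinuity_of_diamond (h : ∀ k : ℕ, 3 ≤ k → DiamondFilmOwnCriticalContinuity k) : ObliqueFilmOwnCriticalContinuity :=
  obliqueFilmOwnCriticalContinuity_iff_diamond.2 h

end Summit.CriticalPhenomena.PercolationContinuityZ3.Theorems.Transplant

end
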